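import Mathlib
import HarnessLib

/-!
# Route `KLProgramme` — ENGINE (stmt-HubbardSuperconductivity-20437 `KLRegimeEngineV17F2`): the ONE-LEG FACTORISATION of a
# modularly conserving four-leg frequency sum and its `L¹` bound `Σ_t |S(t)| ≤ N⁻¹ ∏ ‖ǧ_i‖₁` (abstract `ZMod N` form)

Cell `gate-hubbard-kl`, seat p1b g23 (registrant lineage), def-free helper `--supports stmt-HubbardSuperconductivity-20437`.

For `g₁ g₂ g₃ g₄ : ZMod N → ℂ` (frequency cut-offs on the Matsubara lattice read modulo `N = 2M`) and times `t₁ t₂ t₃ : ZMod N`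
(the fourth leg pinned at time `0`), the four-leg sum with the fourth frequency DETERMINED by modular conservation,
`S(t) = Σ_{n₁ n₂ n₃} g₁ n₁ · g₂ n₂ · g₃ n₃ · g₄ (n₁ - n₂ + n₃) · ψ(n₁ t₁) ψ(n₂ t₂) ψ(n₃ t₃)` (`ψ = ZMod.stdAddChar`, `ψ j = e^{2πij/N}`),
FACTORISES OVER A COMMON TIME `s` (discrete Fourier inversion of `g₄` = the modular-conservation identity `[m ≡ 0] = N⁻¹ Σ_s ψ(s m)`):
`S(t) = N⁻¹ Σ_s ǧ₄(s) · ǧ₁(-(t₁+s)) · ǧ₂(-(t₂-s)) · ǧ₃(-(t₃+s))`, `ǧ = ZMod.dft g` (`klct_fourLeg_sum_eq_commonTime`), whence by the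
triangle inequality and translation invariance of `Σ` over `ZMod N` the normalised `L¹` mass obeys
`Σ_{t₁ t₂ t₃} ‖S(t)‖ ≤ N⁻¹ · ‖ǧ₁‖₁ ‖ǧ₂‖₁ ‖ǧ₃‖₁ ‖ǧ₄‖₁` (`klct_fourLeg_l1_le`).  With `Θ := N⁻³ Σ_t |S(t)|` and `A_i := N⁻¹ ‖ǧ_i‖₁` this is
`Θ ≤ A₁ A₂ A₃ A₄` — the finite-sum half of the k3c2 lineage's post-KILL item (i) «`Θ^cut ≤ A⁴`» (HOME/hubbard-kl-k3c2-p2/g34/CUT-CURRENCY-DIGITS.md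
rev 2, one-leg factorisation; tree companion ✓ `klbv_plainCurrency_uvCut_hubbardInteraction_eq`), stated on `ZMod N` so that the model bookkeeping
(`MatsubaraIdx M = Fin (2M)`, charge signs, the `ℤ`-versus-modular conservation in the cut's support) is the instantiating seat's.
Pure finite-sum algebra on Mathlib's `ZMod.dft` / `ZMod.stdAddChar`; no definition, no estimate of the model; nothing here asserts any
registered row, K3, U₀, the window, a margin or superconductivity in the Hubbard model.
References: BGM 2006 §2.3 (2.17) (Matsubara sums of the quartic vertex) [cite: BenfattoGiulianiMastropietro2006]; discrete Fourier inversion [folklore].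
-/

noncomputable section

namespace Summit.HubbardSuperconductivity.HubbardSuperconductivity.Theorems.KLRegimeSplit

set_option linter.dupNamespace false -- summit = problem name (single-conjunct summit), D-0017

open Finset

variable {N : ℕ} [NeZero N]

/-- Discrete Fourier inversion, pointwise: `g m = N⁻¹ Σ_s ψ(s m) ǧ(s)` with `ǧ = ZMod.dft g`. [folklore] -/
theorem klct_dft_inversion (g : ZMod N → ℂ) (m : ZMod N) :
    g m = (N : ℂ)⁻¹ * ∑ s : ZMod N, ZMod.stdAddChar (s * m) * ZMod.dft g s := by
  have h : g m = (ZMod.dft.symm (ZMod.dft g)) m := by rw [LinearEquiv.symm_apply_apply]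
  rw [h, ZMod.invDFT_apply]
  simp only [smul_eq_mul]

/-- A single leg read against a phase is the discrete Fourier transform at the reflected time:
`Σ_n g n ψ(n u) = ǧ(-u)`. [folklore] -/
theorem klct_sum_mul_stdAddChar_eq_dft (g : ZMod N → ℂ) (u : ZMod N) :
    ∑ n : ZMod N, g n * ZMod.stdAddChar (n * u) = ZMod.dft g (-u) := by
  rw [ZMod.dft_apply]
  refine Finset.sum_congr rfl fun n _ => ?_
  rw [smul_eq_mul, mul_comm (g n)]
  congr 2
  ring

/-- Character algebra on the conserving combination: `ψ(s(n₁ - n₂ + n₃)) = ψ(s n₁) ψ(-(s n₂)) ψ(s n₃)`. [folklore] -/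
theorem klct_stdAddChar_conserving_split (s n₁ n₂ n₃ : ZMod N) :
    (ZMod.stdAddChar (s * (n₁ - n₂ + n₃)) : ℂ) =
      ZMod.stdAddChar (s * n₁) * ZMod.stdAddChar (-(s * n₂)) * ZMod.stdAddChar (s * n₃) := by
  rw [← AddChar.map_add_eq_mul, ← AddChar.map_add_eq_mul]
  congr 1
  ring

/-- Merging two phases of one leg: `ψ(n t) ψ(a) = ψ(n t + a)` read as `ψ(n u)` for the displayed `u`. [folklore] -/
theorem klct_stdAddChar_mul_eq (x y z : ZMod N) (h : x + y = z) :
    (ZMod.stdAddChar x : ℂ) * ZMod.stdAddChar y = ZMod.stdAddChar z := by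
  rw [← AddChar.map_add_eq_mul, h]

/-- Distributing a constant over a triple product of sums:
`Σ_{n₁ n₂ n₃} c · (B₁ n₁ · B₂ n₂ · B₃ n₃) = c · (Σ B₁)(Σ B₂)(Σ B₃)`. [folklore] -/
theorem klct_sum₃_const_mul_prod (c : ℂ) (B₁ B₂ B₃ : ZMod N → ℂ) :
    ∑ n₁ : ZMod N, ∑ n₂ : ZMod N, ∑ n₃ : ZMod N, c * (B₁ n₁ * B₂ n₂ * B₃ n₃) =
      c * ((∑ n, B₁ n) * (∑ n, B₂ n) * (∑ n, B₃ n)) := by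
  rw [Finset.sum_mul_sum, Finset.sum_mul, Finset.mul_sum]
  refine Finset.sum_congr rfl fun n₁ _ => ?_
  rw [Finset.sum_mul, Finset.mul_sum]
  refine Finset.sum_congr rfl fun n₂ _ => ?_
  rw [Finset.mul_sum, Finset.mul_sum]

/-- The same distribution over `ℝ` (used on the norms). [folklore] -/
theorem klct_sum₃_const_mul_prod_real (c : ℝ) (B₁ B₂ B₃ : ZMod N → ℝ) :
    ∑ n₁ : ZMod N, ∑ n₂ : ZMod N, ∑ n₃ : ZMod N, c * (B₁ n₁ * B₂ n₂ * B₃ n₃) =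
      c * ((∑ n, B₁ n) * (∑ n, B₂ n) * (∑ n, B₃ n)) := by
  rw [Finset.sum_mul_sum, Finset.sum_mul, Finset.mul_sum]
  refine Finset.sum_congr rfl fun n₁ _ => ?_
  rw [Finset.sum_mul, Finset.mul_sum]
  refine Finset.sum_congr rfl fun n₂ _ => ?_
  rw [Finset.mul_sum, Finset.mul_sum]

/-- **ONE-LEG FACTORISATION (common-time form).** For `g₁ g₂ g₃ g₄ : ZMod N → ℂ` and times `t₁ t₂ t₃`, the four-leg sum with the fourth
frequency fixed by modular conservation `n₄ = n₁ - n₂ + n₃` factorises over a common time `s`: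
`Σ_{n₁ n₂ n₃} g₁ n₁ g₂ n₂ g₃ n₃ g₄(n₁-n₂+n₃) ψ(n₁t₁)ψ(n₂t₂)ψ(n₃t₃) = N⁻¹ Σ_s ǧ₄(s) ǧ₁(-(t₁+s)) ǧ₂(-(t₂-s)) ǧ₃(-(t₃+s))`, `ǧ = ZMod.dft g`.
(Other charge-sign patterns follow by `tᵢ ↦ -tᵢ` / `gᵢ ↦ gᵢ ∘ neg`.) [cite: BenfattoGiulianiMastropietro2006, §2.3 (2.17)] -/
theorem klct_fourLeg_sum_eq_commonTime (g₁ g₂ g₃ g₄ : ZMod N → ℂ) (t₁ t₂ t₃ : ZMod N) :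
    ∑ n₁ : ZMod N, ∑ n₂ : ZMod N, ∑ n₃ : ZMod N,
        g₁ n₁ * g₂ n₂ * g₃ n₃ * g₄ (n₁ - n₂ + n₃) *
          (ZMod.stdAddChar (n₁ * t₁) * ZMod.stdAddChar (n₂ * t₂) * ZMod.stdAddChar (n₃ * t₃)) =
      (N : ℂ)⁻¹ * ∑ s : ZMod N, ZMod.dft g₄ s *
        (ZMod.dft g₁ (-(t₁ + s)) * ZMod.dft g₂ (-(t₂ - s)) * ZMod.dft g₃ (-(t₃ + s))) := by
  -- the three single legs on the right, read back as sums
  have hR : ∀ s : ZMod N,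
      ZMod.dft g₁ (-(t₁ + s)) * ZMod.dft g₂ (-(t₂ - s)) * ZMod.dft g₃ (-(t₃ + s)) =
        (∑ n, g₁ n * ZMod.stdAddChar (n * (t₁ + s))) * (∑ n, g₂ n * ZMod.stdAddChar (n * (t₂ - s))) *
          (∑ n, g₃ n * ZMod.stdAddChar (n * (t₃ + s))) := by
    intro s
    rw [klct_sum_mul_stdAddChar_eq_dft, klct_sum_mul_stdAddChar_eq_dft, klct_sum_mul_stdAddChar_eq_dft]
  simp_rw [hR]
  -- expand `g₄` by Fourier inversion and distribute termwise
  have hterm : ∀ n₁ n₂ n₃ : ZMod N,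
      g₁ n₁ * g₂ n₂ * g₃ n₃ * g₄ (n₁ - n₂ + n₃) *
          (ZMod.stdAddChar (n₁ * t₁) * ZMod.stdAddChar (n₂ * t₂) * ZMod.stdAddChar (n₃ * t₃)) =
        ∑ s : ZMod N, (N : ℂ)⁻¹ * ZMod.dft g₄ s *
          ((g₁ n₁ * ZMod.stdAddChar (n₁ * (t₁ + s))) * (g₂ n₂ * ZMod.stdAddChar (n₂ * (t₂ - s))) *
            (g₃ n₃ * ZMod.stdAddChar (n₃ * (t₃ + s)))) := by
    intro n₁ n₂ n₃
    rw [klct_dft_inversion g₄ (n₁ - n₂ + n₃), Finset.mul_sum, Finset.mul_sum, Finset.sum_mul]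
    refine Finset.sum_congr rfl fun s _ => ?_
    have h₁ : (ZMod.stdAddChar (n₁ * t₁) : ℂ) * ZMod.stdAddChar (s * n₁) = ZMod.stdAddChar (n₁ * (t₁ + s)) :=
      klct_stdAddChar_mul_eq _ _ _ (by ring)
    have h₂ : (ZMod.stdAddChar (n₂ * t₂) : ℂ) * ZMod.stdAddChar (-(s * n₂)) = ZMod.stdAddChar (n₂ * (t₂ - s)) :=
      klct_stdAddChar_mul_eq _ _ _ (by ring)
    have h₃ : (ZMod.stdAddChar (n₃ * t₃) : ℂ) * ZMod.stdAddChar (s * n₃) = ZMod.stdAddChar (n₃ * (t₃ + s)) :=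
      klct_stdAddChar_mul_eq _ _ _ (by ring)
    rw [klct_stdAddChar_conserving_split, ← h₁, ← h₂, ← h₃]
    ring
  simp_rw [hterm]
  -- move the common time `s` outermost (three adjacent swaps, innermost first) and collect the three single sums
  refine Eq.trans (Finset.sum_congr rfl fun n₁ _ => Finset.sum_congr rfl fun n₂ _ => Finset.sum_comm) ?_
  refine Eq.trans (Finset.sum_congr rfl fun n₁ _ => Finset.sum_comm) ?_
  rw [Finset.sum_comm, Finset.mul_sum]
  refine Finset.sum_congr rfl fun s _ => ?_
  rw [klct_sum₃_const_mul_prod]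
  ring

/-- **THE `L¹` BOUND (`Θ ≤ A⁴` in abstract form).** With `S(t)` the modularly conserving four-leg sum of
`klct_fourLeg_sum_eq_commonTime` and `ǧᵢ = ZMod.dft gᵢ`:
`Σ_{t₁ t₂ t₃} ‖S(t)‖ ≤ N⁻¹ · (Σ‖ǧ₁‖)(Σ‖ǧ₂‖)(Σ‖ǧ₃‖)(Σ‖ǧ₄‖)`; dividing by `N³`, `Θ := N⁻³ Σ_t ‖S(t)‖ ≤ ∏ᵢ (N⁻¹‖ǧᵢ‖₁)`.
Triangle inequality + translation invariance of `Σ` over `ZMod N`; the fourth leg's time is pinned at `0`.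
[cite: BenfattoGiulianiMastropietro2006, §2.3 (2.17)] -/
theorem klct_fourLeg_l1_le (g₁ g₂ g₃ g₄ : ZMod N → ℂ) :
    ∑ t₁ : ZMod N, ∑ t₂ : ZMod N, ∑ t₃ : ZMod N,
        ‖∑ n₁ : ZMod N, ∑ n₂ : ZMod N, ∑ n₃ : ZMod N,
            g₁ n₁ * g₂ n₂ * g₃ n₃ * g₄ (n₁ - n₂ + n₃) *
              (ZMod.stdAddChar (n₁ * t₁) * ZMod.stdAddChar (n₂ * t₂) * ZMod.stdAddChar (n₃ * t₃))‖ ≤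
      (N : ℝ)⁻¹ * ((∑ s, ‖ZMod.dft g₁ s‖) * (∑ s, ‖ZMod.dft g₂ s‖) * (∑ s, ‖ZMod.dft g₃ s‖) *
        (∑ s, ‖ZMod.dft g₄ s‖)) := by
  simp_rw [klct_fourLeg_sum_eq_commonTime]
  -- pointwise triangle inequality
  have hpt : ∀ t₁ t₂ t₃ : ZMod N,
      ‖(N : ℂ)⁻¹ * ∑ s : ZMod N, ZMod.dft g₄ s *
          (ZMod.dft g₁ (-(t₁ + s)) * ZMod.dft g₂ (-(t₂ - s)) * ZMod.dft g₃ (-(t₃ + s)))‖ ≤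
        ∑ s : ZMod N, (N : ℝ)⁻¹ * ‖ZMod.dft g₄ s‖ *
          (‖ZMod.dft g₁ (-(t₁ + s))‖ * ‖ZMod.dft g₂ (-(t₂ - s))‖ * ‖ZMod.dft g₃ (-(t₃ + s))‖) := by
    intro t₁ t₂ t₃
    rw [norm_mul, norm_inv, Complex.norm_natCast]
    calc (N : ℝ)⁻¹ * ‖∑ s : ZMod N, ZMod.dft g₄ s *
            (ZMod.dft g₁ (-(t₁ + s)) * ZMod.dft g₂ (-(t₂ - s)) * ZMod.dft g₃ (-(t₃ + s)))‖
        ≤ (N : ℝ)⁻¹ * ∑ s : ZMod N, ‖ZMod.dft g₄ s *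
            (ZMod.dft g₁ (-(t₁ + s)) * ZMod.dft g₂ (-(t₂ - s)) * ZMod.dft g₃ (-(t₃ + s)))‖ :=
          mul_le_mul_of_nonneg_left (norm_sum_le _ _) (by positivity)
      _ = ∑ s : ZMod N, (N : ℝ)⁻¹ * ‖ZMod.dft g₄ s‖ *
            (‖ZMod.dft g₁ (-(t₁ + s))‖ * ‖ZMod.dft g₂ (-(t₂ - s))‖ * ‖ZMod.dft g₃ (-(t₃ + s))‖) := by
          rw [Finset.mul_sum]
          refine Finset.sum_congr rfl fun s _ => ?_
          rw [norm_mul, norm_mul, norm_mul]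
          ring
  refine (Finset.sum_le_sum fun t₁ _ => Finset.sum_le_sum fun t₂ _ => Finset.sum_le_sum fun t₃ _ =>
    hpt t₁ t₂ t₃).trans (le_of_eq ?_)
  -- common time `s` outermost (three adjacent swaps, innermost first)
  refine Eq.trans (Finset.sum_congr rfl fun t₁ _ => Finset.sum_congr rfl fun t₂ _ => Finset.sum_comm) ?_
  refine Eq.trans (Finset.sum_congr rfl fun t₁ _ => Finset.sum_comm) ?_
  rw [Finset.sum_comm]
  -- translation invariance of the three time sums
  have h₁ : ∀ s : ZMod N, ∑ t₁ : ZMod N, ‖ZMod.dft g₁ (-(t₁ + s))‖ = ∑ u, ‖ZMod.dft g₁ u‖ := by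
    intro s
    simpa using ((Equiv.addRight s).trans (Equiv.neg (ZMod N))).sum_comp (fun u => ‖ZMod.dft g₁ u‖)
  have h₂ : ∀ s : ZMod N, ∑ t₂ : ZMod N, ‖ZMod.dft g₂ (-(t₂ - s))‖ = ∑ u, ‖ZMod.dft g₂ u‖ := by
    intro s
    simpa using ((Equiv.subRight s).trans (Equiv.neg (ZMod N))).sum_comp (fun u => ‖ZMod.dft g₂ u‖)
  have h₃ : ∀ s : ZMod N, ∑ t₃ : ZMod N, ‖ZMod.dft g₃ (-(t₃ + s))‖ = ∑ u, ‖ZMod.dft g₃ u‖ := by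
    intro s
    simpa using ((Equiv.addRight s).trans (Equiv.neg (ZMod N))).sum_comp (fun u => ‖ZMod.dft g₃ u‖)
  have hs : ∀ s : ZMod N,
      ∑ t₁ : ZMod N, ∑ t₂ : ZMod N, ∑ t₃ : ZMod N, (N : ℝ)⁻¹ * ‖ZMod.dft g₄ s‖ *
          (‖ZMod.dft g₁ (-(t₁ + s))‖ * ‖ZMod.dft g₂ (-(t₂ - s))‖ * ‖ZMod.dft g₃ (-(t₃ + s))‖) =
        (N : ℝ)⁻¹ * ‖ZMod.dft g₄ s‖ *
          ((∑ u, ‖ZMod.dft g₁ u‖) * (∑ u, ‖ZMod.dft g₂ u‖) * (∑ u, ‖ZMod.dft g₃ u‖)) := by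
    intro s
    rw [klct_sum₃_const_mul_prod_real, h₁ s, h₂ s, h₃ s]
  simp_rw [hs]
  have hfac : ∀ s : ZMod N, (N : ℝ)⁻¹ * ‖ZMod.dft g₄ s‖ *
        ((∑ u, ‖ZMod.dft g₁ u‖) * (∑ u, ‖ZMod.dft g₂ u‖) * (∑ u, ‖ZMod.dft g₃ u‖)) =
      ‖ZMod.dft g₄ s‖ * ((N : ℝ)⁻¹ *
        ((∑ u, ‖ZMod.dft g₁ u‖) * (∑ u, ‖ZMod.dft g₂ u‖) * (∑ u, ‖ZMod.dft g₃ u‖))) := fun s => by ring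
  simp_rw [hfac]
  rw [← Finset.sum_mul]
  ring

end Summit.HubbardSuperconductivity.HubbardSuperconductivity.Theorems.KLRegimeSplit

end
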